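import Mathlib
import Summits.Ventures.PercRepro2.ExplorationTreeCondExp
import Summits.Ventures.PercRepro2.ExplorationCondExp

/-!
# The fixed-set exploration is the non-adaptive tree (blind cell PercRepro2, typer-1 g19; a
language line)

`ExplorationCondExp.lean` (g18) conditions on a FIXED explored set `F` (`exploredSigma F`,
`exploredMean`); `ExplorationTreeCondExp.lean` conditions on a stopping exploration `t`
(`leafSigma t`, `leafMean`).  The first is the case of the second for the tree that reveals the
edges of a list in a fixed order, whatever it sees (`fixedTree es`):

* `leafOf_fixedTree`: the leaf reached by `fixedTree es` from `P` explores `P.F ∪ es` and records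
  the states of `es` seen in `ω`; `valid_fixedTree`: the tree is valid when `es` has no repeats;
* **`leafSigma_fixedTree`**: `leafSigma (fixedTree es) = exploredSigma es.toFinset`;
* **`leafMean_fixedTree`**: `leafMean p (fixedTree es) f = exploredMean p es.toFinset f`;
* `condExp_exploredSigma_of_fixedTree`: g18's `condExp_exploredSigma` re-derived from
  `condExp_leafSigma` (for a list without repeats) — the two proofs agree.

Identities only; nothing about the sign of any term.
-/

namespace Summit.Ventures.PercRepro2

open MeasureTheory ProbabilityTheory MeasureBridge

namespace ExplorationTree

section Fixed

variable {E : Type*} [DecidableEq E]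

/-- The non-adaptive tree: reveal the edges of `es` in order, whatever is seen. -/
def fixedTree : List E → ETree E
  | [] => .leaf
  | e :: es => .node e (fixedTree es) (fixedTree es)

/-- `fixedTree es` is valid from `F` when `es` has no repeats and avoids `F`. -/
lemma valid_fixedTree : ∀ (es : List E) (F : Finset E), es.Nodup → (∀ e ∈ es, e ∉ F) →
    Valid (fixedTree es) F
  | [], _, _, _ => trivial
  | e :: es, F, hnd, hF => by
    rw [List.nodup_cons] at hnd
    have hrest : ∀ e' ∈ es, e' ∉ insert e F := fun e' he' h => by
      rw [Finset.mem_insert] at h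
      rcases h with h | h
      · exact hnd.1 (h ▸ he')
      · exact hF e' (List.mem_cons_of_mem e he') h
    exact ⟨hF e List.mem_cons_self, valid_fixedTree es _ hnd.2 hrest,
      valid_fixedTree es _ hnd.2 hrest⟩

omit [DecidableEq E] in
/-- A branching on a Boolean with equal subtrees. -/
lemma ite_eq_apply (b : Bool) (g : Bool → Partial E) :
    (if b then g true else g false) = g b := by
  cases b <;> simp

/-- The leaf reached by the non-adaptive tree: explore `P.F ∪ es`, record the states of `es`. -/
lemma leafOf_fixedTree : ∀ (es : List E) (P : Partial E) (ω : Config E),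
    leafOf (fixedTree es) P ω = ⟨P.F ∪ es.toFinset, fun e => if e ∈ es then ω e else P.σ e⟩
  | [], P, ω => by
    simp only [fixedTree, leafOf_leaf, List.toFinset_nil, Finset.union_empty, List.not_mem_nil,
      if_false]
  | e :: es, P, ω => by
    simp only [fixedTree, leafOf_node]
    rw [ite_eq_apply (ω e) (fun b => leafOf (fixedTree es) (P.extend e b) ω),
      leafOf_fixedTree es (P.extend e (ω e)) ω]
    simp only [Partial.extend, List.toFinset_cons, Finset.insert_union, Finset.union_insert]
    congr 1
    funext e'
    by_cases h1 : e' ∈ es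
    · simp [h1]
    · by_cases h2 : e' = e
      · subst h2
        simp [h1]
      · simp [h1, h2]

/-- The leaf reached from the root by the non-adaptive tree, in g18's vocabulary: the explored
pattern extended by `false`. -/
lemma leafOf_fixedTree_root (es : List E) (ω : Config E) :
    leafOf (fixedTree es) root ω =
      ⟨es.toFinset, EdgeSplit.extendPat es.toFinset (EdgeSplit.restrictTo es.toFinset ω)⟩ := by
  rw [leafOf_fixedTree]
  simp only [root, Finset.empty_union]
  congr 1
  funext e
  simp only [EdgeSplit.extendPat, EdgeSplit.restrictTo, List.mem_toFinset]
  by_cases h : e ∈ es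
  · simp [h]
  · simp [h]

/-- The observed pattern of the leaf reached is the observed pattern of the configuration. -/
lemma restrictTo_leafOf_fixedTree (es : List E) (ω : Config E) :
    EdgeSplit.restrictTo es.toFinset (leafOf (fixedTree es) root ω).σ =
      EdgeSplit.restrictTo es.toFinset ω := by
  rw [leafOf_fixedTree_root]
  funext e
  simp only [EdgeSplit.restrictTo, EdgeSplit.extendPat, e.2, dite_true]

end Fixed

section Sigma

variable {E : Type*} [Fintype E] [DecidableEq E]

/-- **The σ-algebra of the non-adaptive tree is the σ-algebra of the explored set**:
`leafSigma (fixedTree es) = exploredSigma es.toFinset`. -/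
theorem leafSigma_fixedTree (es : List E) :
    leafSigma (fixedTree es) = EdgeSplit.exploredSigma es.toFinset := by
  apply le_antisymm
  · have h : leafOf (fixedTree es) root =
        (fun τ => (⟨es.toFinset, EdgeSplit.extendPat es.toFinset τ⟩ : Partial E)) ∘
          EdgeSplit.restrictTo es.toFinset :=
      funext (leafOf_fixedTree_root es)
    have hΦ : @Measurable (↥es.toFinset → Bool) (Partial E) inferInstance ⊤
        (fun τ => (⟨es.toFinset, EdgeSplit.extendPat es.toFinset τ⟩ : Partial E)) :=
      @measurable_of_finite _ _ _ ⊤ _ _ _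
    show MeasurableSpace.comap (leafOf (fixedTree es) root) ⊤ ≤ _
    rw [h, ← MeasurableSpace.comap_comp]
    exact MeasurableSpace.comap_mono hΦ.comap_le
  · have h : EdgeSplit.restrictTo es.toFinset =
        (fun ℓ : Partial E => EdgeSplit.restrictTo es.toFinset ℓ.σ) ∘ leafOf (fixedTree es) root :=
      funext fun ω => (restrictTo_leafOf_fixedTree es ω).symm
    show MeasurableSpace.comap (EdgeSplit.restrictTo es.toFinset) _ ≤ _
    rw [h, ← MeasurableSpace.comap_comp]
    exact MeasurableSpace.comap_mono le_top

/-- **The pinned mean at the leaf of the non-adaptive tree is the pinned mean at the explored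
pattern**: `leafMean p (fixedTree es) f = exploredMean p es.toFinset f`. -/
theorem leafMean_fixedTree (p : E → ℝ) (es : List E) (f : Config E → ℝ) :
    leafMean p (fixedTree es) f = EdgeSplit.exploredMean p es.toFinset f := by
  funext ω
  simp only [leafMean, EdgeSplit.exploredMean]
  rw [leafOf_fixedTree_root, pin_eq_condWeights]
  simp only
  rw [EdgeSplit.condWeights_extendPat_restrictTo]

/-- g18's `condExp_exploredSigma` re-derived from `condExp_leafSigma` for the non-adaptive tree
(a list without repeats) — the fixed-set exploration is the non-adaptive stopping exploration. -/
theorem condExp_exploredSigma_of_fixedTree (p : E → ℝ) (hp : IsProbVec p) (es : List E)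
    (hnd : es.Nodup) (f : Config E → ℝ) :
    (percMeasureOf p hp)[f | EdgeSplit.exploredSigma es.toFinset] =ᵐ[percMeasureOf p hp]
      EdgeSplit.exploredMean p es.toFinset f := by
  rw [← leafSigma_fixedTree, ← leafMean_fixedTree]
  exact condExp_leafSigma p hp (fixedTree es) (valid_fixedTree es ∅ hnd fun _ _ => Finset.notMem_empty _) f

end Sigma

end ExplorationTree

end Summit.Ventures.PercRepro2
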